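import Summits.QuantumFields.YangMills.Theorems.BalabanUVNodesN09HregOfPerBondChartsAtRecord
import Literature.MeasureTheory.Function.MeasurableInvFunOn

/-!
# NODE N09 [B12] — THE PER-BOND INVERSION DATA OF `…N09HregOfPerBondChartsAtRecord` FROM INJECTIVITY WINDOWS AND FORWARD LAWS ALONE
# (Lusin–Souslin supplies the jointly measurable inverses; the inverse law is the forward law read backwards), and `hreg` in that currency

Cell `pub-ymgap` (YM-PLAN Track A), width seat `pub-ymgap-dag-n09-w6` g3; helper of K1⁷ `StabilityBAtRecordR13SepCoPH` = stmt-QuantumFields-20542 (`--supports`,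
`--as helper`, count-neutral).  [I] = [Balaban1987RG1].

WHY.  The prequel (`…N09HregOfPerBondChartsAtRecord`, this seat) delivers the analytic inclusion `hreg` of the N09 doors from PER-BOND INVERSION DATA of the
(0.4) one-variable fibre maps `g ↦ Ū′(c)`, `U′ = U[β(c) ↦ g]`, of the averaging of record in its private coordinates: a window `Ω`, an image window `T`,
a JOINTLY measurable inverse `ϑ` and a density `jd` with `hright`∕`hlaw`.  Two of the four are not independent data: by Lusin–Souslin
(`Literature.MeasureTheory.Function.exists_measurable_fibrewiseInverse`, [Kechris1995] 15.1–15.2) INJECTIVITY of `g ↦ Ū′(c)` on jointly measurable windows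
ALONE yields the image windows and ONE jointly measurable two-sided inverse; and by `T4TriangularFibredChart.restrict_eq_map_withDensity_of_leftInvOn` the
INVERSE change-of-variables law is the FORWARD law `dW⌊(image) = (g ↦ Ū′(c))_*(jac · dg⌊Ω)` (the shape `HaarExpChartChangeOfVariables.
haar_restrict_image_eq_map_withDensity_jacobian` ∕ `FieldMeasureExpChartChangeOfVariables` produce for maps `C¹` in the exponential chart) read backwards with
density `(jac ∘ ϑ)⁻¹`.  THIS FILE does that bookkeeping at the record's types, so that the private-coordinate road to `hreg` displays, per step and bond,
ONLY: a blind measurable window on which the one-variable (0.4) map is injective, its forward Jacobian law, the support clause, and the fibre-integral continuity.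

WHAT IS PROVED (0 def, 0 sorry).  §1 `measurable_oneVariable_record` · ★★ `exists_perBondCharts_of_injectivityWindows` (one level `j < K`: `∃ T ϑ jd` with joint
measurability, `hright`, `hlaw`, `T = image`, left inverse, `ϑ ∈ Ω` on `T`).  §2 ★★★ `exists_hreg_data_of_injectivityWindows` — all levels `j < P.K`: from blind
injectivity windows + forward laws, per-bond inversion data for EVERY step in the exact hypothesis shape of the prequel's `hreg_of_perBondCharts` (whose remaining
inputs — (I19) `hint`, the support clause `hS`, the continuity `hgc` along the produced chart — stay the caller's).

HONEST FRAMING.  Count-neutral kernel bookkeeping; NO window is constructed and NO injectivity or Jacobian law of the (0.4) fibre map is proved here (they are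
HYPOTHESES — the located successor piece; local-diffeomorphism inputs `T4EMLTangentInjective`, `…N07CentralResponseOnto`/`…NormalForm`); nothing of Bałaban's
asserted; `hreg` RE-SHAPED not discharged; N09 NOT discharged; conjunct 1 (Lemma 4) and FLAG №7 untouched; K0⁷∕K1⁷ NOT closed; counts unmoved (typed 28∕28 ·
discharged 5∕27); one finite four-torus programme at fixed `ε = L^{−K}` — R4 closes the conditional rung `BalabanLadder.UV` only; NOT ℝ⁴ ∕ infinite volume ∕ OS;
the Yang–Mills mass gap (Clay) is NOT proved by any of this.
-/

noncomputable section

namespace Summit.QuantumFields.YangMills.BalabanUVNodes.N09PerBondChartsOfInjectivityWindows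

open MeasureTheory Set Function
open scoped ENNReal NNReal
open Literature.MathematicalPhysics.QuantumFieldTheory.Balaban1983to89
open Literature.MathematicalPhysics.QuantumFieldTheory.Balaban1983to89.T4Continuum (T4Family)
open Literature.MathematicalPhysics.QuantumFieldTheory.Balaban1983to89.Node00
open Literature.MathematicalPhysics.QuantumFieldTheory.Balaban1983to89.BlockAveragingHaarAC (centralBond)
open Literature.MathematicalPhysics.QuantumFieldTheory.Balaban1983to89.T4TriangularFibredChart (restrict_eq_map_withDensity_of_leftInvOn)
open Literature.MeasureTheory.Function (exists_measurable_fibrewiseInverse)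

variable {F : T4Family} {N : ℕ} [NeZero N]

/-! ## §1  One level: image windows, jointly measurable inverses and inverse laws from injectivity windows and forward laws -/

section OneLevel

variable {K j : ℕ}

/-- The one-variable map `(U, g) ↦ Ū′(c)`, `U′ = U[β(c) ↦ g]`, of the averaging of record is jointly measurable. [cite: Balaban1987RG1, (0.4) p.253 (bookkeeping)] -/
theorem measurable_oneVariable_record [DecidableEq (PBond (F.P K) j)] (c : PBond (F.P K) (j + 1)) :
    Measurable fun p : GaugeField (F.P K) j (SU N) × SU N => (avOfRecord F N K j).avg (update p.1 (centralBond c) p.2) c :=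
  (measurable_pi_apply c).comp ((avOfRecord_measurable F N K j).comp
    ((measurable_update' (a := centralBond c)).comp (measurable_fst.prodMk measurable_snd)))

/-- ★★ **PER-BOND INVERSION DATA FROM INJECTIVITY WINDOWS AND FORWARD LAWS** (one level `j`).  Given, per coarse bond `c`, a jointly measurable window `Ω_c(U) ⊆ SU(N)`
on which `g ↦ Ū′(c)` is injective, and the FORWARD law of one-bond Haar measure under it with a jointly measurable density `jac_c(U,·)` non-vanishing on the window,
there are image windows `T_c(U) = (g ↦ Ū′(c)) '' Ω_c(U)` (jointly measurable), ONE jointly measurable inverse `ϑ_c` (left inverse on `Ω`, right inverse on `T` with values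
in `Ω`) and the density `jd_c(U,v) = (jac_c(U, ϑ_c(U,v)))⁻¹` carrying the INVERSE law `dg⌊Ω_c(U) = ϑ_c(U,·)_*(jd_c(U,·) · dv⌊T_c(U))` — the data of
`…N09HregOfPerBondChartsAtRecord` at level `j`. [cite: Kechris1995, Thm 15.1 and Cor 15.2; Balaban1987RG1, (0.4) p.253 and (2.10) p.267 (bookkeeping)] -/
theorem exists_perBondCharts_of_injectivityWindows [DecidableEq (PBond (F.P K) j)]
    (Ω : PBond (F.P K) (j + 1) → GaugeField (F.P K) j (SU N) → Set (SU N))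
    (hΩm : ∀ c, MeasurableSet {p : GaugeField (F.P K) j (SU N) × SU N | p.2 ∈ Ω c p.1})
    (hinj : ∀ c U, InjOn (fun g => (avOfRecord F N K j).avg (update U (centralBond c) g) c) (Ω c U))
    (jac : PBond (F.P K) (j + 1) → GaugeField (F.P K) j (SU N) → SU N → ℝ≥0)
    (hjacm : ∀ c, Measurable fun p : GaugeField (F.P K) j (SU N) × SU N => jac c p.1 p.2)
    (hjac0 : ∀ c U, ∀ g ∈ Ω c U, jac c U g ≠ 0)
    (hfwd : ∀ c U, (HaarData.haar : Measure (SU N)).restrict ((fun g => (avOfRecord F N K j).avg (update U (centralBond c) g) c) '' Ω c U) =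
      (((HaarData.haar : Measure (SU N)).restrict (Ω c U)).withDensity fun g => (jac c U g : ℝ≥0∞)).map
        (fun g => (avOfRecord F N K j).avg (update U (centralBond c) g) c)) :
    ∃ (T : PBond (F.P K) (j + 1) → GaugeField (F.P K) j (SU N) → Set (SU N))
      (ϑ : PBond (F.P K) (j + 1) → GaugeField (F.P K) j (SU N) → SU N → SU N)
      (jd : PBond (F.P K) (j + 1) → GaugeField (F.P K) j (SU N) → SU N → ℝ≥0),
      (∀ c, MeasurableSet {p : GaugeField (F.P K) j (SU N) × SU N | p.2 ∈ T c p.1}) ∧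
      (∀ c, Measurable fun p : GaugeField (F.P K) j (SU N) × SU N => ϑ c p.1 p.2) ∧
      (∀ c, Measurable fun p : GaugeField (F.P K) j (SU N) × SU N => jd c p.1 p.2) ∧
      (∀ c U, ∀ v ∈ T c U, (avOfRecord F N K j).avg (update U (centralBond c) (ϑ c U v)) c = v) ∧
      (∀ c U, (HaarData.haar : Measure (SU N)).restrict (Ω c U) =
        (((HaarData.haar : Measure (SU N)).restrict (T c U)).withDensity fun v => (jd c U v : ℝ≥0∞)).map (ϑ c U)) ∧
      (∀ c U, T c U = (fun g => (avOfRecord F N K j).avg (update U (centralBond c) g) c) '' Ω c U) ∧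
      (∀ c U, ∀ g ∈ Ω c U, ϑ c U ((avOfRecord F N K j).avg (update U (centralBond c) g) c) = g) ∧
      (∀ c U, ∀ v ∈ T c U, ϑ c U v ∈ Ω c U) := by
  -- per bond: Lusin–Souslin
  have key : ∀ c, ∃ θ : GaugeField (F.P K) j (SU N) × SU N → SU N, Measurable θ ∧
      (∀ U, ∀ g ∈ Ω c U, θ (U, (avOfRecord F N K j).avg (update U (centralBond c) g) c) = g) ∧
      (∀ U, ∀ v ∈ (fun g => (avOfRecord F N K j).avg (update U (centralBond c) g) c) '' Ω c U,
        (avOfRecord F N K j).avg (update U (centralBond c) (θ (U, v))) c = v ∧ θ (U, v) ∈ Ω c U) := fun c =>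
    (exists_measurable_fibrewiseInverse (Ψ := fun p : GaugeField (F.P K) j (SU N) × SU N =>
      (avOfRecord F N K j).avg (update p.1 (centralBond c) p.2) c) (Ω := Ω c) (measurable_oneVariable_record c) (hΩm c) (hinj c)).2
  have keyT : ∀ c, MeasurableSet {p : GaugeField (F.P K) j (SU N) × SU N |
      p.2 ∈ (fun g => (avOfRecord F N K j).avg (update p.1 (centralBond c) g) c) '' Ω c p.1} := fun c =>
    (exists_measurable_fibrewiseInverse (Ψ := fun p : GaugeField (F.P K) j (SU N) × SU N =>
      (avOfRecord F N K j).avg (update p.1 (centralBond c) p.2) c) (Ω := Ω c) (measurable_oneVariable_record c) (hΩm c) (hinj c)).1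
  choose θ hθm hleft hright using key
  refine ⟨fun c U => (fun g => (avOfRecord F N K j).avg (update U (centralBond c) g) c) '' Ω c U, fun c U v => θ c (U, v),
    fun c U v => (jac c U (θ c (U, v)))⁻¹, keyT, fun c => hθm c, fun c => ?_, fun c U v hv => (hright c U v hv).1, fun c U => ?_,
    fun c U => rfl, fun c U g hg => hleft c U g hg, fun c U v hv => (hright c U v hv).2⟩
  · exact ((hjacm c).comp (measurable_fst.prodMk (hθm c))).inv
  · -- the inverse law from the forward law
    have hΩU : MeasurableSet (Ω c U) := (measurable_const.prodMk measurable_id) (hΩm c)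
    have hψ : Measurable fun g => (avOfRecord F N K j).avg (update U (centralBond c) g) c :=
      (measurable_pi_apply c).comp ((avOfRecord_measurable F N K j).comp (measurable_update U))
    have hθU : Measurable fun v => θ c (U, v) := (hθm c).comp (measurable_const.prodMk measurable_id)
    have hjacU : Measurable fun g => (jac c U g : ℝ≥0∞) := measurable_coe_nnreal_ennreal.comp ((hjacm c).comp (measurable_const.prodMk measurable_id))
    have h := restrict_eq_map_withDensity_of_leftInvOn (ν := (HaarData.haar : Measure (SU N))) hΩU hψ hθU (hleft c U) hjacU
      (fun g hg => by exact_mod_cast hjac0 c U g hg) (fun g _ => ENNReal.coe_ne_top) (hfwd c U)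
    rw [h]
    congr 1
    refine withDensity_congr_ae ?_
    filter_upwards [ae_restrict_mem (keyT c |> fun h => (measurable_const.prodMk measurable_id) h)] with v hv
    rw [ENNReal.coe_inv (hjac0 c U _ ((hright c U v hv).2))]

end OneLevel

/-! ## §2  All levels: the hypothesis bundle of `hreg_of_perBondCharts` from injectivity windows and forward laws -/

/-- ★★★ **THE PER-BOND INVERSION DATA FOR EVERY STEP `j < P.K`, FROM BLIND INJECTIVITY WINDOWS AND FORWARD LAWS.**  The output is EXACTLY the bundle
`(T, ϑ, jd; hTm, hθm, hjm, hright, hlaw)` consumed by `…N09HregOfPerBondChartsAtRecord.hreg_of_perBondCharts` (with the caller's own `Ω`, `hΩm`, `hΩbl`), together with the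
identification of the image windows and the two-sided inverse properties a caller needs to discharge the support clause and the fibre-integral continuity.
[cite: Kechris1995, Thm 15.1 and Cor 15.2; Balaban1987RG1, p.259, (0.4) p.253 and (2.10) p.267 (bookkeeping)] -/
theorem exists_hreg_data_of_injectivityWindows (P : B12.RunParams) [∀ j, DecidableEq (PBond (F.P P.K) j)]
    (Ω : ∀ j, PBond (F.P P.K) (j + 1) → GaugeField (F.P P.K) j (SU N) → Set (SU N))
    (hΩm : ∀ j < P.K, ∀ c, MeasurableSet {p : GaugeField (F.P P.K) j (SU N) × SU N | p.2 ∈ Ω j c p.1})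
    (hinj : ∀ j < P.K, ∀ c U, InjOn (fun g => (avOfRecord F N P.K j).avg (update U (centralBond c) g) c) (Ω j c U))
    (jac : ∀ j, PBond (F.P P.K) (j + 1) → GaugeField (F.P P.K) j (SU N) → SU N → ℝ≥0)
    (hjacm : ∀ j < P.K, ∀ c, Measurable fun p : GaugeField (F.P P.K) j (SU N) × SU N => jac j c p.1 p.2)
    (hjac0 : ∀ j < P.K, ∀ c U, ∀ g ∈ Ω j c U, jac j c U g ≠ 0)
    (hfwd : ∀ j < P.K, ∀ c U,
      (HaarData.haar : Measure (SU N)).restrict ((fun g => (avOfRecord F N P.K j).avg (update U (centralBond c) g) c) '' Ω j c U) =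
        (((HaarData.haar : Measure (SU N)).restrict (Ω j c U)).withDensity fun g => (jac j c U g : ℝ≥0∞)).map
          (fun g => (avOfRecord F N P.K j).avg (update U (centralBond c) g) c)) :
    ∃ (T : ∀ j, PBond (F.P P.K) (j + 1) → GaugeField (F.P P.K) j (SU N) → Set (SU N))
      (ϑ : ∀ j, PBond (F.P P.K) (j + 1) → GaugeField (F.P P.K) j (SU N) → SU N → SU N)
      (jd : ∀ j, PBond (F.P P.K) (j + 1) → GaugeField (F.P P.K) j (SU N) → SU N → ℝ≥0),
      (∀ j < P.K, ∀ c, MeasurableSet {p : GaugeField (F.P P.K) j (SU N) × SU N | p.2 ∈ T j c p.1}) ∧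
      (∀ j < P.K, ∀ c, Measurable fun p : GaugeField (F.P P.K) j (SU N) × SU N => ϑ j c p.1 p.2) ∧
      (∀ j < P.K, ∀ c, Measurable fun p : GaugeField (F.P P.K) j (SU N) × SU N => jd j c p.1 p.2) ∧
      (∀ j < P.K, ∀ c U, ∀ v ∈ T j c U, (avOfRecord F N P.K j).avg (update U (centralBond c) (ϑ j c U v)) c = v) ∧
      (∀ j < P.K, ∀ c U, (HaarData.haar : Measure (SU N)).restrict (Ω j c U) =
        (((HaarData.haar : Measure (SU N)).restrict (T j c U)).withDensity fun v => (jd j c U v : ℝ≥0∞)).map (ϑ j c U)) ∧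
      (∀ j < P.K, ∀ c U, T j c U = (fun g => (avOfRecord F N P.K j).avg (update U (centralBond c) g) c) '' Ω j c U) ∧
      (∀ j < P.K, ∀ c U, ∀ g ∈ Ω j c U, ϑ j c U ((avOfRecord F N P.K j).avg (update U (centralBond c) g) c) = g) ∧
      (∀ j < P.K, ∀ c U, ∀ v ∈ T j c U, ϑ j c U v ∈ Ω j c U) := by
  classical
  -- at each level `j < P.K` use §1; off range take junk data (never read)
  have key : ∀ j, ∃ (T : PBond (F.P P.K) (j + 1) → GaugeField (F.P P.K) j (SU N) → Set (SU N))
      (ϑ : PBond (F.P P.K) (j + 1) → GaugeField (F.P P.K) j (SU N) → SU N → SU N)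
      (jd : PBond (F.P P.K) (j + 1) → GaugeField (F.P P.K) j (SU N) → SU N → ℝ≥0), j < P.K →
      (∀ c, MeasurableSet {p : GaugeField (F.P P.K) j (SU N) × SU N | p.2 ∈ T c p.1}) ∧
      (∀ c, Measurable fun p : GaugeField (F.P P.K) j (SU N) × SU N => ϑ c p.1 p.2) ∧
      (∀ c, Measurable fun p : GaugeField (F.P P.K) j (SU N) × SU N => jd c p.1 p.2) ∧
      (∀ c U, ∀ v ∈ T c U, (avOfRecord F N P.K j).avg (update U (centralBond c) (ϑ c U v)) c = v) ∧
      (∀ c U, (HaarData.haar : Measure (SU N)).restrict (Ω j c U) =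
        (((HaarData.haar : Measure (SU N)).restrict (T c U)).withDensity fun v => (jd c U v : ℝ≥0∞)).map (ϑ c U)) ∧
      (∀ c U, T c U = (fun g => (avOfRecord F N P.K j).avg (update U (centralBond c) g) c) '' Ω j c U) ∧
      (∀ c U, ∀ g ∈ Ω j c U, ϑ c U ((avOfRecord F N P.K j).avg (update U (centralBond c) g) c) = g) ∧
      (∀ c U, ∀ v ∈ T c U, ϑ c U v ∈ Ω j c U) := by
    intro j
    by_cases hj : j < P.K
    · obtain ⟨T, ϑ, jd, h1, h2, h3, h4, h5, h6, h7, h8⟩ := exists_perBondCharts_of_injectivityWindows (Ω j) (hΩm j hj) (hinj j hj)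
        (jac j) (hjacm j hj) (hjac0 j hj) (hfwd j hj)
      exact ⟨T, ϑ, jd, fun _ => ⟨h1, h2, h3, h4, h5, h6, h7, h8⟩⟩
    · exact ⟨fun _ _ => ∅, fun _ _ v => v, fun _ _ _ => 0, fun h => absurd h hj⟩
  choose T ϑ jd hkey using key
  exact ⟨T, ϑ, jd, fun j hj => (hkey j hj).1, fun j hj => (hkey j hj).2.1, fun j hj => (hkey j hj).2.2.1, fun j hj => (hkey j hj).2.2.2.1,
    fun j hj => (hkey j hj).2.2.2.2.1, fun j hj => (hkey j hj).2.2.2.2.2.1, fun j hj => (hkey j hj).2.2.2.2.2.2.1,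
    fun j hj => (hkey j hj).2.2.2.2.2.2.2⟩

end Summit.QuantumFields.YangMills.BalabanUVNodes.N09PerBondChartsOfInjectivityWindows

end
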